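import Summits.QuantumFields.YangMills.Theorems.FluctuationComparisonRegPrIntLS2BetaInterBlockFace
import Summits.QuantumFields.YangMills.Theorems.FluctuationComparisonRegPrIntLS2BetaOneStepOfInterBlock
import Summits.QuantumFields.YangMills.Theorems.FluctuationComparisonRegPrIntLS2BetaGapOrbitOfTubeReg
import HarnessLib

/-!
# GAP♯∘'s KINEMATIC LETTER INTER₀∘ PROVED — THE SWEEP OVER THE FACE; ONE-STEP-ROOTED₀∘ AND CLOSE-PAIR∘ AS THEOREMS
# (crux `FluctuationComparisonRegPrIntL`, stmt-QuantumFields-20520; registry v11.4 `Cruxes/FluctuationComparisonRegPrIntL/Lines/semiclassical_s2beta.lean` 3732b7df FROZEN, untouched)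

Cell `ym3-torus` (YM ladder rung R3 = continuum `SU(2)` Yang–Mills on the three-torus — a RUNG: NOT d = 4, NOT infinite volume, NOT a mass gap, NOT Clay).
Seat `ym3-torus-px8` (gen 18; pen INTER₀∘, ★★OWNER WORD №205 ∕ LEAD WORD №14); `--kind proof --supports stmt-QuantumFields-20520 --as helper`, count-neutral,
DEFINITION-FREE (0 `def`, 0 `instance`, 0 `notation`, 0 `sorry`, default heartbeats).  Parts A ∕ B: ✓`…S2BetaInterBlockCentral` (central crossing link of a face),
✓`…S2BetaInterBlockFace` (loop-free face transfer, crossing-site geometry).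

WHAT.
* §1 `ℓ¹` bookkeeping of the relative coordinates on a face (`l1`, one step towards the axis).
* §2 ★★ `dist1_cross_le_sweep` — THE SWEEP: on the face between `B(y)` and `B(y + e_μ)`, every crossing link `⟨emb y + v, μ⟩` (`|v|_∞ ≤ h`, `v_μ = h`) is within
  `n·(2d(L−1) + 1)·(δ_W + δ_Y)` of the central one, `n ≥ |v|₁ − h` (induction on `n`, one face step of part B at a time).
* §3 ★★★ `interBlock_holds : ⟨INTER₀∘ VERBATIM⟩` — the `hI` hypothesis of ✓`…S2BetaOneStepOfInterBlock.oneStepRooted₀_of_interBlock`, i.e. the second half of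
  [Balaban1985RegularSpaces] Lemma 1 for one block level on the finest lattice: in the relative comb-axial gauge every bond JOINING two neighbouring blocks is within
  `α₁ + C(L)·α₀` (`C(L) = 75L² + 3h(12(L−1)+2)`, `a₀(L) = 1∕(25(L²+1))`, coefficient ONE on `α₁`): central link (part A: `α₁ + 75L²α₀` via the (0.4) structure
  `Ū(c) = corr·U(c)` and ✓`dist1_corr_le`) + sweep (§2 with `n = 3h`).
* §4 ★★★ `oneStepRooted₀_holds`, ★★★★ `closePair_holds` — ✓`oneStepRooted₀_of_interBlock` ∕ ✓`closePair_of_interBlock` (ymfull-r3-prover-3 №7) applied to §3: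
  ONE-STEP-ROOTED₀∘ and CLOSE-PAIR∘ hold for every `T3Family`.
* §5 ★★★★ `uniformFibreGapOrbit_of_tubeReg_of_thm1` — ✓p784179 `uniformFibreGapOrbit_of_tubeReg_of_closePair_of_thm1` with its CLOSE-PAIR∘ binder discharged by §4:
  «GAP♯∘ (registry v11.4 text) ⟸ {TUBE-REG∘, [Balaban1985Variational] Thm 1 letter}» in ONE theorem by name (ymfull-r3-prover-3's ask).

NET (CREDIT: mechanism [Balaban1985RegularSpaces] Lemma 1 ∕ [Balaban1985Averaging] pp. 24–25; reductions №7∕№8 by `ymfull-r3-prover-3`; comb-axial carriers by their authors):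
with ✓p784179 the books read «GAP♯∘ ⟸ {TUBE-REG∘, Thm-1 letter}» — INTER₀∘ is no longer a hypothesis.  HONEST: TUBE-REG∘, GAP♯∘, EXW∘, S2β, crux 20520 are NOT proved
here; no summit statement is proved by a helper; finite-volume ∕ conditional; rung R3 = SU(2) YM₃ on T³ — NOT d = 4, NOT infinite volume, NOT a mass gap, NOT Clay; the
Yang–Mills mass gap is NOT proved.  Sorry-free, axioms standard.

References: T. Bałaban, CMP **99** (1985) 75–102 [Balaban1985RegularSpaces] ((1.19) p.79, Lemma 1 (1.24)–(1.26) pp.79–80); CMP **98** (1985) 17–51 [Balaban1985Averaging]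
((19)–(20) p.21, pp.24–25); CMP **109** (1987) 249–301 [Balaban1987RG1] ((0.3)–(0.4) pp.252–253); CMP **102** (1985) 255–275 [Balaban1985UV3] ((12)–(13) p.259).
-/

set_option autoImplicit false

noncomputable section

open MeasureTheory Filter Topology Set
open scoped Matrix.Norms.L2Operator
open Literature.MathematicalPhysics.QuantumFieldTheory.Balaban1983to89
open Literature.MathematicalPhysics.QuantumFieldTheory.Balaban1983to89.T3ContinuumYM3Torus
open Literature.MathematicalPhysics.QuantumFieldTheory.Balaban1983to89.T3UnitLawDensityEML
open Literature.MathematicalPhysics.QuantumFieldTheory.Balaban1983to89.T3UnitScaleTilt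
open Literature.MathematicalPhysics.QuantumFieldTheory.Balaban1983to89.T3TiltDescent
open Literature.MathematicalPhysics.QuantumFieldTheory.Balaban1983to89.T3PrintedRegularMinimiser
open Literature.MathematicalPhysics.QuantumFieldTheory.Balaban1983to89.T3PrintedRegularOrbits
open Literature.MathematicalPhysics.QuantumFieldTheory.Balaban1983to89.T3PrintedMinimiserExistence
open Literature.MathematicalPhysics.QuantumFieldTheory.Balaban1983to89.T3LowerAlongMinimisersSplit (MinimisersIn8At)
open Literature.MathematicalPhysics.QuantumFieldTheory.Balaban1983to89.T3ConstrainedMinimiser (fibre)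
open Literature.MathematicalPhysics.QuantumFieldTheory.Balaban1983to89.Missing
open Literature.MathematicalPhysics.QuantumFieldTheory.Balaban1983to89.T4Continuum
open Summit.QuantumFields.YangMills.Theorems.FluctuationComparisonRegPrIntLS2BetaResidualGauge
open Summit.QuantumFields.YangMills.Theorems.FluctuationComparisonRegPrIntLS2BetaResidualGaugeOrbit
open Summit.QuantumFields.YangMills.Theorems.FluctuationComparisonRegPrIntLWindowExactnessOfGapOrbitThm1
open Summit.QuantumFields.YangMills.Theorems.FluctuationComparisonRegPrIntLS2BetaGapOrbitOfTubeReg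
  (uniformFibreGapOrbit_of_tubeReg_of_closePair_of_thm1)
open B7Prop1Explicit (e e_apply l1)
open B10Eq27TorusAxialLog (axialT rel transl transl_add_e transl_rel)
open B5Eq118OneStroke (iterBlockOf)
open B15DeterminingSets (embIter)
open ExpMeanLog (deltaSU)
open Summit.QuantumFields.YangMills.Theorems.FluctuationComparisonRegPrIntLS2BetaInterBlockCentral
  (blockOf_transl_emb blockOf_axisPt blockOf_axisPt_shift dist1_central_link_le)
open Summit.QuantumFields.YangMills.Theorems.FluctuationComparisonRegPrIntLS2BetaInterBlockFace
  (dist1_cross_shift_le dist1_cross_le_shift cross_of_rel exists_rel_of_cross natAbs_rel_emb_le_of_blockOf)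
open Summit.QuantumFields.YangMills.Theorems.FluctuationComparisonRegPrIntLS2BetaOneStepOfInterBlock
  (oneStepRooted₀_of_interBlock closePair_of_interBlock)

namespace Summit.QuantumFields.YangMills.Theorems.FluctuationComparisonRegPrIntLS2BetaInterBlock

/-! ## §1 `ℓ¹` bookkeeping on the face -/

section L1

variable {d : ℕ}

/-- `|v|₁ = |v_μ| + Σ_{ι ≠ μ} |v_ι|`. [folklore] -/
theorem l1_eq_add_sum_erase (v : B7Prop1Explicit.Site d) (μ : Fin d) :
    l1 v = (v μ).natAbs + ∑ ι ∈ Finset.univ.erase μ, (v ι).natAbs := by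
  unfold l1
  rw [Finset.add_sum_erase _ (fun ι => (v ι).natAbs) (Finset.mem_univ μ)]

/-- On the face, `|v|₁ ≤ h` forces `v = h·e_μ` (the axis point). [folklore] -/
theorem eq_axisVec_of_l1_le {v : B7Prop1Explicit.Site d} {μ : Fin d} {h : ℕ} (hvμ : v μ = (h : ℤ)) (hl : l1 v ≤ h) :
    v = (h : ℤ) • e μ := by
  have hsum := l1_eq_add_sum_erase v μ
  rw [hvμ, Int.natAbs_natCast] at hsum
  have hrest : ∑ ι ∈ Finset.univ.erase μ, (v ι).natAbs = 0 := by omega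
  funext ι
  rw [Pi.smul_apply, e_apply]
  by_cases hι : ι = μ
  · subst hι; rw [if_pos rfl, smul_eq_mul, mul_one, hvμ]
  · rw [if_neg hι, smul_zero]
    exact Int.natAbs_eq_zero.mp (Finset.sum_eq_zero_iff.mp hrest ι (Finset.mem_erase.mpr ⟨hι, Finset.mem_univ _⟩))

/-- On the face, `|v|₁ > h` gives a transverse direction `κ ≠ μ` with `v_κ ≠ 0`. [folklore] -/
theorem exists_ne_zero_of_lt_l1 {v : B7Prop1Explicit.Site d} {μ : Fin d} {h : ℕ} (hvμ : v μ = (h : ℤ)) (hl : h < l1 v) :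
    ∃ κ, κ ≠ μ ∧ v κ ≠ 0 := by
  by_contra hall
  push Not at hall
  have hsum := l1_eq_add_sum_erase v μ
  rw [hvμ, Int.natAbs_natCast, Finset.sum_eq_zero (fun ι hι => by rw [hall ι (Finset.ne_of_mem_erase hι), Int.natAbs_zero])] at hsum
  omega

/-- One step towards the axis from the negative side shortens `|v|₁` by one. [folklore] -/
theorem l1_add_e_succ_of_neg {v : B7Prop1Explicit.Site d} {κ : Fin d} (hκ : v κ < 0) : l1 (v + e κ) + 1 = l1 v := by
  rw [l1_eq_add_sum_erase (v + e κ) κ, l1_eq_add_sum_erase v κ]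
  have hrest : ∑ ι ∈ Finset.univ.erase κ, ((v + e κ) ι).natAbs = ∑ ι ∈ Finset.univ.erase κ, (v ι).natAbs :=
    Finset.sum_congr rfl fun ι hι => by rw [Pi.add_apply, e_apply, if_neg (Finset.ne_of_mem_erase hι), add_zero]
  rw [hrest, Pi.add_apply, e_apply, if_pos rfl]
  have hk : (v κ + 1).natAbs + 1 = (v κ).natAbs := by
    rcases Int.natAbs_eq (v κ) with hh | hh <;> rcases Int.natAbs_eq (v κ + 1) with hh' | hh' <;> omega
  omega

/-- One step towards the axis from the positive side shortens `|v|₁` by one. [folklore] -/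
theorem l1_sub_e_succ_of_pos {v : B7Prop1Explicit.Site d} {κ : Fin d} (hκ : 0 < v κ) : l1 (v - e κ) + 1 = l1 v := by
  rw [l1_eq_add_sum_erase (v - e κ) κ, l1_eq_add_sum_erase v κ]
  have hrest : ∑ ι ∈ Finset.univ.erase κ, ((v - e κ) ι).natAbs = ∑ ι ∈ Finset.univ.erase κ, (v ι).natAbs :=
    Finset.sum_congr rfl fun ι hι => by rw [Pi.sub_apply, e_apply, if_neg (Finset.ne_of_mem_erase hι), sub_zero]
  rw [hrest, Pi.sub_apply, e_apply, if_pos rfl]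
  have hk : (v κ - 1).natAbs + 1 = (v κ).natAbs := by
    rcases Int.natAbs_eq (v κ) with hh | hh <;> rcases Int.natAbs_eq (v κ - 1) with hh' | hh' <;> omega
  omega

end L1

/-! ## §2 The sweep over the face -/

section Sweep

variable {P : Params} {G : Type*} [GaugeGroup G]

/-- ★★ **THE SWEEP.**  Level `0`, one block level, `W` comb-axial relative to `Y`, plaquette variables within `δ_W, δ_Y ≥ 0` of `1`: on the face of `B(y)` towards
`B(y + e_μ)`, every crossing link `⟨emb y + v, μ⟩` with `|v|_∞ ≤ h`, `v_μ = h`, `|v|₁ ≤ h + n` is within `n·(2d(L−1)+1)·(δ_W + δ_Y)` of the central one `⟨emb y + h·e_μ, μ⟩`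
— induction on `n`, one face transfer (part B) per step, always towards the axis. [cite: Balaban1985RegularSpaces, Lemma 1 (1.25) p.79; Balaban1985Averaging, pp.24-25] -/
theorem dist1_cross_le_sweep (hk : 1 ≤ P.m + P.K) (W Y : GaugeField P 0 G) {δW δY : ℝ} (hδW : 0 ≤ δW) (hδY : 0 ≤ δY)
    (hW : PlaqSmall δW W) (hY : PlaqSmall δY Y)
    (hax : ∀ x : Site P 0, axialT W (embIter 1 (iterBlockOf 1 x)) x = axialT Y (embIter 1 (iterBlockOf 1 x)) x)
    (y : Site P 1) (μ : Fin P.d) :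
    ∀ (n : ℕ) (v : B7Prop1Explicit.Site P.d), (∀ ν, (v ν).natAbs ≤ (P.L - 1) / 2) → v μ = (((P.L - 1) / 2 : ℕ) : ℤ) →
      l1 v ≤ (P.L - 1) / 2 + n →
      dist1 (W ⟨transl (emb y) v, μ⟩ * (Y ⟨transl (emb y) v, μ⟩)⁻¹) ≤
        dist1 (W ⟨transl (emb y) ((((P.L - 1) / 2 : ℕ) : ℤ) • e μ), μ⟩ *
            (Y ⟨transl (emb y) ((((P.L - 1) / 2 : ℕ) : ℤ) • e μ), μ⟩)⁻¹) +
          (n : ℝ) * ((2 * ((P.d : ℝ) * ((P.L : ℝ) - 1)) + 1) * (δW + δY))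
  | 0, v, hv, hvμ, hl => by
    rw [eq_axisVec_of_l1_le hvμ (by simpa using hl), Nat.cast_zero, zero_mul, add_zero]
  | n + 1, v, hv, hvμ, hl => by
    have hj : 0 + 1 ≤ P.m + P.K := hk
    have hs : 0 ≤ (2 * ((P.d : ℝ) * ((P.L : ℝ) - 1)) + 1) * (δW + δY) := by
      have hL : (1 : ℝ) ≤ P.L := by exact_mod_cast P.L_pos
      have : (0 : ℝ) ≤ (P.d : ℝ) * ((P.L : ℝ) - 1) := mul_nonneg (Nat.cast_nonneg _) (by linarith)
      positivity
    have hcast : (((n + 1 : ℕ)) : ℝ) = (n : ℝ) + 1 := by push_cast; ring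
    rw [hcast]
    by_cases hle : l1 v ≤ (P.L - 1) / 2 + n
    · have ih := dist1_cross_le_sweep hk W Y hδW hδY hW hY hax y μ n v hv hvμ hle
      nlinarith
    · obtain ⟨κ, hκμ, hκ⟩ := exists_ne_zero_of_lt_l1 hvμ (by omega)
      rcases lt_or_gt_of_ne hκ with hneg | hpos
      · -- `v_κ < 0`: the neighbour `v + e_κ` is one step closer to the axis; transfer BACKWARD at base `emb y + v`
        have hv' : ∀ ν, ((v + e κ) ν).natAbs ≤ (P.L - 1) / 2 := fun ν => by
          rw [Pi.add_apply, e_apply]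
          by_cases hν : ν = κ
          · subst hν; rw [if_pos rfl]
            have h1 := hv ν
            rcases Int.natAbs_eq (v ν) with hh | hh <;> rcases Int.natAbs_eq (v ν + 1) with hh' | hh' <;> omega
          · rw [if_neg hν, add_zero]; exact hv ν
        have hv'μ : (v + e κ) μ = (((P.L - 1) / 2 : ℕ) : ℤ) := by rw [Pi.add_apply, e_apply, if_neg (Ne.symm hκμ), add_zero, hvμ]
        have hl' : l1 (v + e κ) ≤ (P.L - 1) / 2 + n := by have := l1_add_e_succ_of_neg hneg; omega
        have ih := dist1_cross_le_sweep hk W Y hδW hδY hW hY hax y μ n (v + e κ) hv' hv'μ hl'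
        have hin : iterBlockOf 1 ((transl (emb y) v).shift κ) = iterBlockOf 1 (transl (emb y) v) := by
          show blockOf ((transl (emb y) v).shift κ) = blockOf (transl (emb y) v)
          rw [← transl_add_e, blockOf_transl_emb hj y hv', blockOf_transl_emb hj y hv]
        have hstep := dist1_cross_le_shift hk W Y hδW hδY hW hY hax (transl (emb y) v) hκμ hin
        rw [← transl_add_e] at hstep
        linarith
      · -- `v_κ > 0`: the neighbour `v − e_κ` is one step closer to the axis; transfer FORWARD at base `emb y + (v − e_κ)`
        have hv' : ∀ ν, ((v - e κ) ν).natAbs ≤ (P.L - 1) / 2 := fun ν => by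
          rw [Pi.sub_apply, e_apply]
          by_cases hν : ν = κ
          · subst hν; rw [if_pos rfl]
            have h1 := hv ν
            rcases Int.natAbs_eq (v ν) with hh | hh <;> rcases Int.natAbs_eq (v ν - 1) with hh' | hh' <;> omega
          · rw [if_neg hν, sub_zero]; exact hv ν
        have hv'μ : (v - e κ) μ = (((P.L - 1) / 2 : ℕ) : ℤ) := by rw [Pi.sub_apply, e_apply, if_neg (Ne.symm hκμ), sub_zero, hvμ]
        have hl' : l1 (v - e κ) ≤ (P.L - 1) / 2 + n := by have := l1_sub_e_succ_of_pos hpos; omega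
        have ih := dist1_cross_le_sweep hk W Y hδW hδY hW hY hax y μ n (v - e κ) hv' hv'μ hl'
        have hin : iterBlockOf 1 ((transl (emb y) (v - e κ)).shift κ) = iterBlockOf 1 (transl (emb y) (v - e κ)) := by
          show blockOf ((transl (emb y) (v - e κ)).shift κ) = blockOf (transl (emb y) (v - e κ))
          rw [← transl_add_e, sub_add_cancel, blockOf_transl_emb hj y hv, blockOf_transl_emb hj y hv']
        have hstep := dist1_cross_shift_le hk W Y hδW hδY hW hY hax (transl (emb y) (v - e κ)) hκμ hin
        rw [← transl_add_e, sub_add_cancel] at hstep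
        linarith

end Sweep

/-! ## §3 INTER₀∘ -/

section Inter

/-- ★★★ **INTER₀∘ HOLDS** — the `hI` hypothesis of ✓`oneStepRooted₀_of_interBlock` VERBATIM ([Balaban1985RegularSpaces] Lemma 1 (1.25), the bonds of `B_j(c)` joining two
blocks, one block level, finest lattice): `W` comb-axial relative to `Y`, both `PlaqSmall α₀` (`α₀ ≤ a₀(L) = 1∕(25(L²+1))`), (0.4)-averages bondwise `α₁`-close ⟹ every crossing
bond is within `α₁ + C(L)·α₀`, `C(L) = 75L² + 3h·(12(L−1)+2)`.  Central link by part A, the rest of the face by the sweep of §2 with `n = 3h`.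
[cite: Balaban1985RegularSpaces, Lemma 1 (1.24)-(1.26) pp.79-80; Balaban1985Averaging, pp.24-25; Balaban1987RG1, (0.4) p.253] -/
theorem interBlock_holds :
    ∀ (L : ℕ), ∃ C : ℝ, 0 ≤ C ∧ ∃ a₀ : ℝ, 0 < a₀ ∧ ∀ (F : T3Family), F.L = L → ∀ (K' : ℕ), 0 < K' →
      ∀ (W Y : GaugeField (F.P K') 0 (Matrix.specialUnitaryGroup (Fin 2) ℂ)) (α₀ α₁ : ℝ), 0 ≤ α₀ → α₀ ≤ a₀ → 0 ≤ α₁ →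
        PlaqSmall α₀ Y → PlaqSmall α₀ W →
        (∀ x : Site (F.P K') 0, axialT W (embIter 1 (iterBlockOf 1 x)) x = axialT Y (embIter 1 (iterBlockOf 1 x)) x) →
        (∀ b : PBond (F.P K') 1,
          dist1 (((BlockAveraging.blockAvg (P := F.P K') (j := 0) ℰp).avg W) b *
            (((BlockAveraging.blockAvg (P := F.P K') (j := 0) ℰp).avg Y) b)⁻¹) ≤ α₁) →
        ∀ (x : Site (F.P K') 0) (μ : Fin (F.P K').d), iterBlockOf 1 (x.shift μ) ≠ iterBlockOf 1 x →
          dist1 (W ⟨x, μ⟩ * (Y ⟨x, μ⟩)⁻¹) ≤ α₁ + C * α₀ := by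
  intro L
  refine ⟨75 * (L : ℝ) ^ 2 + 3 * (((L - 1) / 2 : ℕ) : ℝ) * (12 * ((L : ℝ) - 1) + 2), ?_,
    1 / (25 * ((L : ℝ) ^ 2 + 1)), by positivity, ?_⟩
  · rcases Nat.eq_zero_or_pos L with hL0 | hLpos
    · subst hL0; norm_num
    · have hL1 : (1 : ℝ) ≤ L := by exact_mod_cast hLpos
      have : (0 : ℝ) ≤ 12 * ((L : ℝ) - 1) + 2 := by linarith
      positivity
  intro F hFL K' hK' W Y α₀ α₁ hα₀ hα₀a hα₁ hY hW hax havg x μ hcross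
  have hk : 1 ≤ (F.P K').m + (F.P K').K := by show 1 ≤ F.m + K'; omega
  have hj : 0 + 1 ≤ (F.P K').m + (F.P K').K := hk
  have hd : ((F.P K').d : ℝ) = 3 := by norm_num [T3Family.P_d]
  have hdn : (F.P K').d = 3 := T3Family.P_d F K'
  have hLL : ((F.P K').L : ℝ) = L := by rw [← hFL]; rfl
  have hLn : (F.P K').L = L := by rw [← hFL]; rfl
  -- the crossing site in relative coordinates over its block `y`
  set y : Site (F.P K') 1 := iterBlockOf 1 x with hy
  have hcross' : blockOf (x.shift μ) ≠ blockOf x := hcross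
  obtain ⟨v, hv, hvμ, hxv⟩ := exists_rel_of_cross hj hcross'
  have hyx : blockOf x = y := rfl
  rw [hyx] at hxv
  -- (A) the central link
  have ht : (((((F.P K').d + 2) * (F.P K').L : ℕ) : ℝ) ^ 2 / 4) * α₀ < deltaSU (Fin 2) := by
    have h1 : (((((F.P K').d + 2) * (F.P K').L : ℕ) : ℝ) ^ 2 / 4) * α₀ ≤ 1 / 4 := by
      rw [hdn, hLn]
      have hsq : (0 : ℝ) ≤ ((((3 + 2) * L : ℕ) : ℝ)) ^ 2 / 4 := by positivity
      have hq : ((((3 + 2) * L : ℕ) : ℝ)) ^ 2 / 4 * (1 / (25 * ((L : ℝ) ^ 2 + 1))) = (L : ℝ) ^ 2 / (4 * ((L : ℝ) ^ 2 + 1)) := by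
        push_cast; field_simp; ring
      calc ((((3 + 2) * L : ℕ) : ℝ)) ^ 2 / 4 * α₀ ≤ ((((3 + 2) * L : ℕ) : ℝ)) ^ 2 / 4 * (1 / (25 * ((L : ℝ) ^ 2 + 1))) :=
            mul_le_mul_of_nonneg_left hα₀a hsq
        _ = (L : ℝ) ^ 2 / (4 * ((L : ℝ) ^ 2 + 1)) := hq
        _ ≤ 1 / 4 := by rw [div_le_iff₀ (by positivity)]; nlinarith
    have h2 : (1 : ℝ) / 4 < deltaSU (Fin 2) := by
      unfold deltaSU
      rw [Fintype.card_fin]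
      refine lt_min (by norm_num) ?_
      have := Real.pi_gt_three
      push_cast
      linarith
    exact h1.trans_lt h2
  have hax₀ : axialT W (emb y) (transl (emb y) (((((F.P K').L - 1) / 2 : ℕ) : ℤ) • e μ)) =
      axialT Y (emb y) (transl (emb y) (((((F.P K').L - 1) / 2 : ℕ) : ℤ) • e μ)) := by
    have h := hax (transl (emb y) (((((F.P K').L - 1) / 2 : ℕ) : ℤ) • e μ))
    have hb : iterBlockOf 1 (transl (emb y) (((((F.P K').L - 1) / 2 : ℕ) : ℤ) • e μ)) = y := blockOf_axisPt hj y μ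
    rwa [hb] at h
  have hax₁ : axialT W (emb (y.shift μ)) ((transl (emb y) (((((F.P K').L - 1) / 2 : ℕ) : ℤ) • e μ)).shift μ) =
      axialT Y (emb (y.shift μ)) ((transl (emb y) (((((F.P K').L - 1) / 2 : ℕ) : ℤ) • e μ)).shift μ) := by
    have h := hax ((transl (emb y) (((((F.P K').L - 1) / 2 : ℕ) : ℤ) • e μ)).shift μ)
    have hb : iterBlockOf 1 ((transl (emb y) (((((F.P K').L - 1) / 2 : ℕ) : ℤ) • e μ)).shift μ) = y.shift μ :=
      blockOf_axisPt_shift hj y μ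
    rwa [hb] at h
  have havg' : dist1 (BlockAveraging.avgFun ℰp W ⟨y, μ⟩ * (BlockAveraging.avgFun ℰp Y ⟨y, μ⟩)⁻¹) ≤ α₁ := by
    have h := havg ⟨y, μ⟩
    rwa [BlockAveraging.blockAvg_avg] at h
  have hcentral := dist1_central_link_le hj hα₀ W Y hW hY ht y μ hax₀ hax₁ havg'
  -- (B) the sweep from the axis point to `x = emb y + v`, `n = 3h ≥ |v|₁ − h`
  have hl : l1 v ≤ ((F.P K').L - 1) / 2 + (F.P K').d * (((F.P K').L - 1) / 2) := by
    have h1 : l1 v ≤ (F.P K').d * (((F.P K').L - 1) / 2) := by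
      unfold l1
      calc ∑ κ, (v κ).natAbs ≤ ∑ _κ : Fin (F.P K').d, ((F.P K').L - 1) / 2 := Finset.sum_le_sum fun κ _ => hv κ
        _ = (F.P K').d * (((F.P K').L - 1) / 2) := by rw [Finset.sum_const, Finset.card_univ, Fintype.card_fin, smul_eq_mul]
    omega
  have hsweep := dist1_cross_le_sweep hk W Y hα₀ hα₀ hW hY hax y μ ((F.P K').d * (((F.P K').L - 1) / 2)) v hv hvμ hl
  rw [← hxv] at hsweep
  -- (C) arithmetic: `2·6·((5L)²∕4) = 75L²`, `3h·(2·3(L−1)+1)·2 = 3h·(12(L−1)+2)` — freeze the two `dist1` atoms first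
  set Dx := dist1 (W ⟨x, μ⟩ * (Y ⟨x, μ⟩)⁻¹) with hDx
  set D0 := dist1 (W ⟨transl (emb y) (((((F.P K').L - 1) / 2 : ℕ) : ℤ) • e μ), μ⟩ *
      (Y ⟨transl (emb y) (((((F.P K').L - 1) / 2 : ℕ) : ℤ) • e μ), μ⟩)⁻¹) with hD0
  rw [hdn, hLn] at hsweep hcentral
  push_cast at hsweep hcentral
  linarith

end Inter

/-! ## §4 ONE-STEP-ROOTED₀∘ and CLOSE-PAIR∘ as theorems -/

section Corollaries

/-- ★★★ **ONE-STEP-ROOTED₀∘ HOLDS** (✓`oneStepRooted₀_of_interBlock` applied to §3): on the finest lattice of every run, two small-plaquette `SU(2)` fields with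
`α₁`-close one-step (0.4)-averages are `(α₁ + C·α₀)`-close on EVERY bond after a ROOTED gauge transformation — [Balaban1985RegularSpaces] Lemma 1 for one block level.
[cite: Balaban1985RegularSpaces, Lemma 1 (1.24)-(1.26) pp.79-80; Balaban1985Averaging, pp.24-25] -/
theorem oneStepRooted₀_holds :
    ∀ (L : ℕ), ∃ C : ℝ, 0 ≤ C ∧ ∃ a₀ : ℝ, 0 < a₀ ∧ ∀ (F : T3Family), F.L = L → ∀ (K' : ℕ), 0 < K' →
      ∀ (Y Y' : GaugeField (F.P K') 0 (Matrix.specialUnitaryGroup (Fin 2) ℂ)) (α₀ α₁ : ℝ), 0 ≤ α₀ → α₀ ≤ a₀ → 0 ≤ α₁ →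
        PlaqSmall α₀ Y → PlaqSmall α₀ Y' →
        (∀ b : PBond (F.P K') 1,
          dist1 (((BlockAveraging.blockAvg (P := F.P K') (j := 0) ℰp).avg Y') b *
            (((BlockAveraging.blockAvg (P := F.P K') (j := 0) ℰp).avg Y) b)⁻¹) ≤ α₁) →
        ∃ w : Site (F.P K') 0 → Matrix.specialUnitaryGroup (Fin 2) ℂ,
          (fun y => w (emb y)) = (fun _ => 1) ∧ ∀ ℓ : PBond (F.P K') 0, dist1 (Y' ℓ * ((GaugeField.gaugeAct w Y) ℓ)⁻¹) ≤ α₁ + C * α₀ :=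
  oneStepRooted₀_of_interBlock interBlock_holds

/-- ★★★★ **CLOSE-PAIR∘ HOLDS FOR EVERY `T3Family`** (✓`closePair_of_interBlock` = ✓`closePair_of_oneStepRooted₀` ∘ §3): two history-good fields in one fibre are
`δ`-close on every finest bond after a fibre-preserving gauge transformation, for `γ ≤ γ₁(L, b₀, p₀, δ)` — the kinematic letter of GAP♯∘'s closeness side.
[cite: Balaban1985RegularSpaces, Lemma 1 (1.25) p.79; Balaban1985UV3, (12)-(13) p.259] -/
theorem closePair_holds :
    ∀ (L : ℕ) (b₀ p₀ : ℝ), 0 < b₀ → 0 < p₀ → ∀ (δ : ℝ), 0 < δ →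
      ∃ γ₁ : ℝ, 0 < γ₁ ∧ ∀ (F : T3Family) (γ : ℝ), F.L = L → 0 < γ → γ ≤ γ₁ →
        ∀ (J K : ℕ) (hJK : J ≤ K) (V : GaugeField (F.P J) 0 (Matrix.specialUnitaryGroup (Fin 2) ℂ)),
          ∀ U' ∈ fibre F ℰp J K hJK V, U' ∈ histGood F ℰp (θBal F.L γ b₀ p₀) K J →
            ∀ U ∈ fibre F ℰp J K hJK V, U ∈ histGood F ℰp (θBal F.L γ b₀ p₀) K J →
              ∃ w : Site (F.P K) 0 → Matrix.specialUnitaryGroup (Fin 2) ℂ,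
                (∀ U'' : GaugeField (F.P K) 0 (Matrix.specialUnitaryGroup (Fin 2) ℂ),
                    descendTo F ℰp J K hJK (GaugeField.gaugeAct w U'') = descendTo F ℰp J K hJK U'') ∧
                  ∀ ℓ : PBond (F.P K) 0, dist1 (U ℓ * ((GaugeField.gaugeAct w U') ℓ)⁻¹) ≤ δ :=
  closePair_of_interBlock interBlock_holds

end Corollaries

/-! ## §5 GAP♯∘ from TUBE-REG∘ and the Thm 1 letter alone -/

section Gap

/-- ★★★★ **GAP♯∘ ⟸ {TUBE-REG∘, Thm-1 letter}** — ✓`uniformFibreGapOrbit_of_tubeReg_of_closePair_of_thm1` (ymfull-r3-prover-3, ✓p784179) with its CLOSE-PAIR∘ hypothesis discharged by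
`closePair_holds`: the registered GAP♯∘ text (`UniformFibreGapOrbit`, registry v11.4) follows from the tube-regularity letter TUBE-REG∘ and the [Balaban1985Variational] Thm 1 (8)
letter.  TUBE-REG∘ and the Thm-1 letter remain HYPOTHESES. [cite: Balaban1985Variational, Thm 1 (8) p.279, (142) p.299; Balaban1985RegularSpaces, Lemma 1 (1.24)-(1.26) pp.79-80] -/
theorem uniformFibreGapOrbit_of_tubeReg_of_thm1
    (hT1 : ∀ (L : ℕ), ∃ c₀ : ℝ, 0 < c₀ ∧ c₀ ≤ 1 ∧ ∀ (cw : ℝ), 0 < cw → cw ≤ c₀ → ∃ pS : ℝ, ∀ (b₀ p₀ : ℝ), 0 < b₀ → pS ≤ p₀ → 0 < p₀ →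
      ∃ ε₁ : ℝ, 0 < ε₁ ∧ ∀ (ε₀ : ℝ), 0 < ε₀ → ε₀ ≤ ε₁ → ∃ δ : ℝ, 0 < δ ∧
      ∃ γ₁ : ℝ, 0 < γ₁ ∧ ∃ μ : ℝ, 0 < μ ∧ ∀ (F : T3Family) (γ : ℝ), F.L = L → 0 < γ → γ ≤ γ₁ →
        ∀ (J K : ℕ) (hJK : J ≤ K) (V : GaugeField (F.P J) 0 (Matrix.specialUnitaryGroup (Fin 2) ℂ)), PlaqSmall (θBal F.L γ (cw * b₀) p₀ J) V →
          ∀ U₀ ∈ regFibrePr F J K hJK ε₀ V, U₀ ∈ histGood F ℰp (θBal F.L γ b₀ p₀) K J →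
            wilsonAction4 U₀ = minActionRegPr F J K hJK ε₀ V →
            ∀ U ∈ fibre F ℰp J K hJK V, U ∈ histGood F ℰp (θBal F.L γ b₀ p₀) K J →
              (∃ w : Site (F.P K) 0 → Matrix.specialUnitaryGroup (Fin 2) ℂ,
                (∀ U'' : GaugeField (F.P K) 0 (Matrix.specialUnitaryGroup (Fin 2) ℂ),
                    descendTo F ℰp J K hJK (GaugeField.gaugeAct w U'') = descendTo F ℰp J K hJK U'') ∧
                  ∀ ℓ : PBond (F.P K) 0, dist1 (U ℓ * ((GaugeField.gaugeAct w U₀) ℓ)⁻¹) ≤ δ) →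
              μ * ((F.L : ℝ)⁻¹) ^ (2 * (K - J)) *
                  (⨅ w : {w : Site (F.P K) 0 → Matrix.specialUnitaryGroup (Fin 2) ℂ |
                      ∀ U : GaugeField (F.P K) 0 (Matrix.specialUnitaryGroup (Fin 2) ℂ),
                        descendTo F ℰp J K hJK (GaugeField.gaugeAct w U) = descendTo F ℰp J K hJK U},
                    ∑ ℓ : PBond (F.P K) 0,
                      dist1 (U ℓ * ((GaugeField.gaugeAct (w : Site (F.P K) 0 → Matrix.specialUnitaryGroup (Fin 2) ℂ) U₀) ℓ)⁻¹) ^ 2)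
                ≤ wilsonAction4 U - minActionRegPr F J K hJK ε₀ V)
    (hT : ∀ L : ℕ, Odd L → 1 < L → ∃ a₀ a₁ B₃ : ℝ, 0 < a₀ ∧ 0 < a₁ ∧ 0 < B₃ ∧ Thm1GlobalMinAt L a₀ a₁ B₃) :
    ∀ (L : ℕ), ∃ c₀ : ℝ, 0 < c₀ ∧ c₀ ≤ 1 ∧ ∀ (cw : ℝ), 0 < cw → cw ≤ c₀ → ∃ pS : ℝ, ∀ (b₀ p₀ : ℝ), 0 < b₀ → pS ≤ p₀ → 0 < p₀ →
      ∃ ε₁ : ℝ, 0 < ε₁ ∧ ∀ (ε₀ : ℝ), 0 < ε₀ → ε₀ ≤ ε₁ →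
      ∃ γ₁ : ℝ, 0 < γ₁ ∧ ∃ μ : ℝ, 0 < μ ∧ ∀ (F : T3Family) (γ : ℝ), F.L = L → 0 < γ → γ ≤ γ₁ →
        ∀ (J K : ℕ) (hJK : J ≤ K) (V : GaugeField (F.P J) 0 (Matrix.specialUnitaryGroup (Fin 2) ℂ)), PlaqSmall (θBal F.L γ (cw * b₀) p₀ J) V →
          ∀ U₀ ∈ {U' | U' ∈ fibre F ℰp J K hJK V ∧ U' ∈ histGood F ℰp (θBal F.L γ b₀ p₀) K J ∧
              wilsonAction4 U' = minActionRegPr F J K hJK ε₀ V},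
            ∀ U ∈ fibre F ℰp J K hJK V, U ∈ histGood F ℰp (θBal F.L γ b₀ p₀) K J →
              μ * ((F.L : ℝ)⁻¹) ^ (2 * (K - J)) *
                  (⨅ w : {w : Site (F.P K) 0 → Matrix.specialUnitaryGroup (Fin 2) ℂ |
                      ∀ U : GaugeField (F.P K) 0 (Matrix.specialUnitaryGroup (Fin 2) ℂ),
                        descendTo F ℰp J K hJK (GaugeField.gaugeAct w U) = descendTo F ℰp J K hJK U},
                    ∑ ℓ : PBond (F.P K) 0,
                      dist1 (U ℓ * ((GaugeField.gaugeAct (w : Site (F.P K) 0 → Matrix.specialUnitaryGroup (Fin 2) ℂ) U₀) ℓ)⁻¹) ^ 2)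
                ≤ wilsonAction4 U - minActionRegPr F J K hJK ε₀ V :=
  uniformFibreGapOrbit_of_tubeReg_of_closePair_of_thm1 hT1 closePair_holds hT

end Gap

end Summit.QuantumFields.YangMills.Theorems.FluctuationComparisonRegPrIntLS2BetaInterBlock

end
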